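import Summits.QuantumFields.YangMills.Theorems.BalabanUVNodesN15KingModelBlockCovarianceContinuumLimit

/-!
# BalabanUVNodes ∕ N15 — THE KING-MODEL RUNG (PART Ϡ-i): NE2's UNIT LAYER OF THE MODEL AGAINST THE CONTINUUM PARTNER — `EtaRateIneqUnit` ∕ `NE2PlusUnit` ∕
# `NE2ZeroUnit` ∕ `N15At` INHABITED BY THE DIFFERENCE `(Δ^{(K)})⁻¹ − C^{(∞)}` (the `n = ∞` two-spacing pair), HYPOTHESIS-FREE, WITH `C^{(∞)}` IN CLOSED FORM
# (Track A, DAG node N15 = NE2; FAN-OUT v1.1 §N15 s3 «KING-MODEL RUNG … NE2's analogue DECIDED in the model»)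

HONEST FRAMING.  Count-neutral (cell `pub-ymgap`, seat `pub-ymgap-dag-n15-e` g32; `--supports stmt-QuantumFields-27366 --as helper` = K3⁸
`SpineGivenEndpointR13SepCoPHV`).  TEMPLATE LITERATURE: C. King, *The U(1) Higgs model. I. The continuum limit*, Commun. Math. Phys. **102** (1986) 649–677
[King1986] — KING's OWN `A = 0` MODEL: the block-field covariance `(Δ^{(K)})⁻¹` ((2.14) p. 653; the rung's g0 `blockCov` on the King-model family `kingVolInstance`,
unit tori `Π ℤ∕(2L^m)`), Lemma 4.5's shape (4.38) p. 674 «|C^{(k)}(x,y) − C^{(k+n)}(x,y)| ≦ CL^{−k}e^{−δ₀|x−y|}» read at `n = ∞`, and the typed NE2 unit-layer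
language of the cell (`T4EtaRate.EtaRateIneqUnit` ∕ `NE2PlusUnit`, [B9] = [Balaban1985BackgroundPropagators] Thm 3.15 (3.187) p. 432 as QUANTIFIER TEMPLATE;
`YMDAG.UVSplit.N15At`).  NOT Bałaban's `C^{(k)}(Λ; U)`; NOT `S_N15 RRec` (the node at the carriers of record); NOT a node discharge (N15 is booked through n15-a's
knit, untouched here); nothing continuum-Yang–Mills ∕ ℝ⁴ ∕ OS ∕ mass-gap ∕ Clay.  0 `sorry`; standard axioms; 3 plumbing `def`s (the kernel family, the carrier bundle).

THE MATHEMATICS.  The g0 unit layer (`…N15KingModelRungUnit`) read NE2's η-difference as the pair (level `K`, level `K + 1`): `|(Δ^{(K+1)})⁻¹ − (Δ^{(K)})⁻¹| ≤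
(C_diff + 1)e^{−(κ_M∕2)|b−b′|}L^{−K}`.  Part Ϡ-e identified the `K → ∞` limit `C^{(∞)} = blockCovLim` IN CLOSED FORM and proved `|(Δ^{(K)})⁻¹(b,b′) − C^{(∞)}(b,b′)| ≤
2C_diff e^{−(κ_M∕2)|b−b′|}L^{−K}` on every unit torus.  Reading the η-difference as the pair (level `K`, level `∞`) — the shape in which (4.38) is USED in Thm 3.4's
proof («two models on the same unit lattice», the second being the limit theory) — the same typed inequalities hold with constants `(δ₀, a₀, B₀, θ) = (κ_M∕2, 1,
2C_diff + 1, L⁻¹)`: `EtaRateIneqUnit` at every index and background (§2), hence `NE2PlusUnit` and `NE2ZeroUnit` (§3), and with the g0 operator∕site layers of the top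
piece the node statement `N15At` at the carriers whose unit kernel is the continuum-partner difference (§4).

WHAT THIS FILE PROVES (kernel).  §1 `blockCovLimStep` ∕ `blockCovLimUnit` (the `n = ∞` difference kernel on the King-model family).  §2 ★★ **`blockCovLim_step_le`**,
★★★ **`etaRateIneqUnit_blockCovLim`**.  §3 ★★★ **`ne2PlusUnit_blockCovLim`**, ★★ `ne2ZeroUnit_blockCovLim`.  §4 `kingVolCarriersLim`, ★★★ **`n15At_kingModelRung_lim`**
(`N15At` at the King-model carriers with the continuum-partner unit kernel; `d + 1 = 4`), `kingVolCarriersLim_index_nonempty`.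

HONEST SCOPE.  King's `A = 0` model on the cubic unit tori `2L^m` (odd `L ≥ 3`), `a, m² > 0`; one-point backgrounds (`U ≡ 1`); the operator∕site layers are the g0
ones (top piece), unchanged.  N15 untouched; counts unmoved.  Locators: [King1986] (2.13)–(2.14) p.653, Thm 3.4 (3.9) p.656, Lemma 4.5 (4.38) p.674, (4.39)–(4.41)
pp.674–675; [Balaban1985BackgroundPropagators] Thm 3.15 (3.187) p.432.
-/

noncomputable section

namespace Summit.QuantumFields.YangMills.BalabanUVNodes.N15KingModelRung

open Real Finset
open Literature.MathematicalPhysics.QuantumFieldTheory.Balaban1983to89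
open Literature.MathematicalPhysics.QuantumFieldTheory.Balaban1983to89.T4EtaRate (PairedInstance EtaRateIneqUnit NE2PlusOperator NE2PlusSite NE2PlusUnit
  NE2ZeroOperator)
open Literature.MathematicalPhysics.QuantumFieldTheory.Balaban1983to89.T4EtaRateSiteOfRatePair (NE2ZeroSite)
open Literature.MathematicalPhysics.QuantumFieldTheory.Balaban1983to89.T4EtaRateUnitWitness (NE2ZeroUnit ne2ZeroUnit_of_ne2PlusUnit)
open Literature.MathematicalPhysics.QuantumFieldTheory.Balaban1983to89.B5Prop11Plancherel (Tor fine)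
open Literature.MathematicalPhysics.QuantumFieldTheory.King1986 (aK)
open Literature.MathematicalPhysics.QuantumFieldTheory.King1986.Torus (tdistT CdiffM kapM CdiffM_nonneg kapM_pos_le)
open YMDAG.UVSplit (NE2Carriers N15At)

variable {d : ℕ}

/-! ## §1 The `n = ∞` difference kernel on the King-model family -/

section Unit

variable (L : ℕ) [NeZero L]

/-- THE `n = ∞` η-DIFFERENCE OF NE2's UNIT-LAYER KERNEL at index `j`: level `K = j.K` minus the continuum partner, `(Δ^{(K)})⁻¹(b, b′) − C^{(∞)}(b, b′)` on the unit
torus `Π ℤ∕(2L^m)`. [cite: King1986, Lemma 4.5 (4.38) p.674 (shape, n = ∞), (2.14) p.653] -/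
def blockCovLimStep (a m2 : ℝ) (j : KingVolIndex d) (b b' : Tor (kingVol L j)) : ℝ :=
  haveI := kingVol_neZero L j
  blockCov L (L ^ j.K) (kingVol L j) a m2 j.K b b' - blockCovLim L (kingVol L j) a m2 b b'

/-- The `n = ∞` difference as the UNIT-LAYER site kernel on the King-model family. [cite: Balaban1985BackgroundPropagators, Thm 3.15 (3.187) p.432 (shape); King1986, (4.38) p.674 (object)] -/
def blockCovLimUnit (a m2 : ℝ) : ∀ j : KingVolIndex d, B9.SiteKernel (kingVolInstance d L j).gc (kingVolInstance d L j).Bf :=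
  fun j => ⟨fun _ b b' => blockCovLimStep L a m2 j b b'⟩

/-! ## §2 The step bound against the limit and the typed unit inequality -/

/-- ★★ **THE (4.38)-SHAPE AGAINST THE LIMIT ON THE KING-MODEL FAMILY** (`L` odd `≥ 2`, `a, m² > 0`): for EVERY index and all unit sites,
`|(Δ^{(K)})⁻¹(b, b′) − C^{(∞)}(b, b′)| ≤ 2C_diff·e^{−(κ_M∕2)|b − b′|_T}·(L^K)⁻¹` — part Ϡ-e's `abs_blockCov_sub_lim_le` BY NAME at the volume `2L^m`.
[cite: King1986, Lemma 4.5 (4.38) p.674, (4.39)–(4.41) pp.674–675] -/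
theorem blockCovLim_step_le (hLodd : Odd L) (hL : 2 ≤ L) {a m2 : ℝ} (ha : 0 < a) (hm : 0 < m2) (j : KingVolIndex d) (b b' : Tor (kingVol L j)) :
    haveI := kingVol_neZero L j
    |blockCovLimStep L a m2 j b b'| ≤
      2 * CdiffM (d + 1) a m2 L * Real.exp (-(kapM (d + 1) a m2 L / 2 * tdistT (kingVol L j) b b')) * ((L : ℝ) ^ j.K)⁻¹ := by
  haveI := kingVol_neZero L j
  have h := abs_blockCov_sub_lim_le L (kingVol L j) hLodd hL ha hm j.one_le_K b b'
  unfold blockCovLimStep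
  convert h using 3

/-- ★★★ **THE TYPED UNIT INEQUALITY AGAINST THE CONTINUUM PARTNER, UNIFORMLY** (`L` odd `≥ 2`, `a, m² > 0`): for EVERY index and (the unique) background,
`EtaRateIneqUnit (blockCovLimUnit L a m² j) (fun _ => True) (kingUnitDist L j) (2C_diff + 1) (κ_M∕2) L⁻¹ K` — rate `θ = L⁻¹`, `θ^K = (L^K)⁻¹`.
[cite: Balaban1985BackgroundPropagators, Thm 3.15 (3.187) p.432 (shape); King1986, (4.38) p.674, (4.41) p.675] -/
theorem etaRateIneqUnit_blockCovLim (hLodd : Odd L) (hL : 2 ≤ L) {a m2 : ℝ} (ha : 0 < a) (hm : 0 < m2) (j : KingVolIndex d)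
    (U : (kingVolInstance d L j).Bf.Cfg) :
    EtaRateIneqUnit (blockCovLimUnit L a m2 j) (fun _ => True) (kingUnitDist L j) (2 * CdiffM (d + 1) a m2 L + 1)
      (kapM (d + 1) a m2 L / 2) ((L : ℝ)⁻¹) j.K U := by
  intro y y' _ _
  haveI := kingVol_neZero L j
  have h := blockCovLim_step_le (d := d) L hLodd hL ha hm j y y'
  have hexp := Real.exp_pos (-(kapM (d + 1) a m2 L / 2 * tdistT (kingVol L j) y y'))
  have hLK : 0 ≤ ((L : ℝ) ^ j.K)⁻¹ := by positivity
  show |blockCovLimStep L a m2 j y y'| ≤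
    (2 * CdiffM (d + 1) a m2 L + 1) * Real.exp (-(kapM (d + 1) a m2 L / 2 * tdistT (kingVol L j) y y')) * ((L : ℝ)⁻¹) ^ j.K
  rw [inv_pow]
  calc |blockCovLimStep L a m2 j y y'|
      ≤ 2 * CdiffM (d + 1) a m2 L * Real.exp (-(kapM (d + 1) a m2 L / 2 * tdistT (kingVol L j) y y')) * ((L : ℝ) ^ j.K)⁻¹ := h
    _ ≤ (2 * CdiffM (d + 1) a m2 L + 1) * Real.exp (-(kapM (d + 1) a m2 L / 2 * tdistT (kingVol L j) y y')) * ((L : ℝ) ^ j.K)⁻¹ := by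
        gcongr
        linarith

/-! ## §3 `NE2PlusUnit` ∕ `NE2ZeroUnit` against the continuum partner -/

/-- ★★★ **`NE2PlusUnit` IS INHABITED BY THE `n = ∞` PAIR `((Δ^{(K)})⁻¹, C^{(∞)})` ON THE KING-MODEL FAMILY, HYPOTHESIS-FREE** (`L` odd `≥ 2`, `a, m² > 0`, every
`c35`): `(δ₀, a₀, B₀, θ) = (κ_M∕2, 1, 2C_diff + 1, L⁻¹)`, uniform in `(m, K, Msz)`; the continuum partner `C^{(∞)}` is part Ϡ-e's EXPLICIT `blockCovLim`.  HONEST SCOPE: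
backgrounds range over `{U ≡ 1}`. [cite: Balaban1985BackgroundPropagators, Thm 3.15 (3.187) p.432 (quantifier template); King1986, Lemma 4.5 (4.38) p.674, (4.39)–(4.41) pp.674–675] -/
theorem ne2PlusUnit_blockCovLim (hLodd : Odd L) (hL : 2 ≤ L) {a m2 : ℝ} (ha : 0 < a) (hm : 0 < m2) (c35 : ℝ) :
    NE2PlusUnit c35 (kingVolInstance d L) (blockCovLimUnit L a m2) (fun _ _ => True) (kingUnitDist L) := by
  have hLpos : (0 : ℝ) < L := by exact_mod_cast (lt_of_lt_of_le zero_lt_two hL)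
  have hθ1 : (L : ℝ)⁻¹ < 1 := inv_lt_one_of_one_lt₀ (by exact_mod_cast hL)
  have hC : 0 < 2 * CdiffM (d + 1) a m2 L + 1 := by linarith [CdiffM_nonneg (d := d + 1) ha hm hL]
  exact ⟨kapM (d + 1) a m2 L / 2, 1, 2 * CdiffM (d + 1) a m2 L + 1, (L : ℝ)⁻¹, half_pos (kapM_pos_le ha hm hL).1, one_pos, hC,
    inv_pos.mpr hLpos, hθ1, fun j _ _ _ U _ _ => etaRateIneqUnit_blockCovLim L hLodd hL ha hm j U⟩

/-- ★★ **`NE2ZeroUnit` FOR THE `n = ∞` PAIR** (same data): the lineage's `ne2ZeroUnit_of_ne2PlusUnit`. [cite: King1986, (4.38) p.674 (A = 0 model, n = ∞)] -/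
theorem ne2ZeroUnit_blockCovLim (hLodd : Odd L) (hL : 2 ≤ L) {a m2 : ℝ} (ha : 0 < a) (hm : 0 < m2) :
    NE2ZeroUnit (kingVolInstance d L) (blockCovLimUnit L a m2) (fun _ _ => True) (kingUnitDist L) :=
  ne2ZeroUnit_of_ne2PlusUnit (c35 := 0) (fun j => lt_of_lt_of_le one_pos j.one_le_Msz) (fun _ _ _ => trivial)
    (fun _ _ _ => trivial) (ne2PlusUnit_blockCovLim L hLodd hL ha hm 0)

end Unit

/-! ## §4 `N15At` at the King-model carriers with the continuum-partner unit kernel -/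

section Node

variable (L : ℕ) [NeZero L]

/-- THE KING-MODEL CARRIER BUNDLE WITH THE CONTINUUM-PARTNER UNIT KERNEL (`d + 1 = 4`): as the g0 `kingVolCarriers` (top piece on the operator and site layers)
but `Kunit := blockCovLimUnit` — the unit-layer η-difference read as (level `K`, level `∞`).  NOT the carriers of record. [cite: King1986, (2.17) p.653, (4.38) p.674 (objects)] -/
def kingVolCarriersLim (a m2 c35 p : ℝ) : NE2Carriers where
  I := KingVolIndex 3
  c35 := c35
  p := p
  pi := kingVolInstance 3 L
  Kop := topPieceOp L a m2
  Ksite := topPieceSite L a m2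
  Kunit := blockCovLimUnit L a m2
  inΛ := fun _ _ => True
  unitDist := kingUnitDist L

/-- ★★★ **`N15At` AT THE KING-MODEL CARRIERS WITH THE CONTINUUM PARTNER, HYPOTHESIS-FREE** (odd `L ≥ 3`, `a, m² > 0`, `0 < γ ≤ 1`, every `c35`, `p`; `d + 1 = 4`):
`NE2PlusOperator ∧ NE2PlusSite 4 p ∧ NE2PlusUnit` on ONE family, the unit layer being the `n = ∞` pair `((Δ^{(K)})⁻¹, C^{(∞)})` with `C^{(∞)}` explicit.  NOT `S_N15 RRec`,
NOT a discharge. [cite: King1986, Prop. 3.9 (3.73) p.665, p.675, Lemma 4.5 (4.38) p.674; Balaban1985BackgroundPropagators, Thm 3.1 p.397 + Thm 3.2 (3.48) p.398 + Thm 3.15 (3.187) p.432 (quantifier templates)] -/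
theorem n15At_kingModelRung_lim (hLodd : Odd L) (hL : 2 ≤ L) {a m2 : ℝ} (ha : 0 < a) (hm : 0 < m2) {γ : ℝ} (hγ0 : 0 < γ) (hγ1 : γ ≤ 1) (c35 p : ℝ) :
    N15At (kingVolCarriersLim L a m2 c35 p) :=
  ⟨ne2PlusOperator_topPiece (d := 3) L hLodd hL ha hm hγ0 hγ1 c35, ne2PlusSite_topPiece (d := 3) L hLodd hL ha hm hγ0 hγ1 4 p c35,
    ne2PlusUnit_blockCovLim (d := 3) L hLodd hL ha hm c35⟩

/-- The bundle's index type is inhabited (not the empty-index trap). [folklore] -/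
theorem kingVolCarriersLim_index_nonempty (a m2 c35 p : ℝ) : Nonempty (kingVolCarriersLim L a m2 c35 p).I :=
  kingVolIndex_nonempty 3

end Node

end Summit.QuantumFields.YangMills.BalabanUVNodes.N15KingModelRung

end
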